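import Summits.ResolutionOfSingularities.ResolutionOfSingularities.Theorems.FrobeniusLadderFInjectiveMacaulayficationE8ChartXPrimesChar3
import Summits.ResolutionOfSingularities.ResolutionOfSingularities.Theorems.FrobeniusLadderFInjectiveMacaulayficationE8ChartYPrimesChar3
import Summits.ResolutionOfSingularities.ResolutionOfSingularities.Theorems.FrobeniusLadderFInjectiveMacaulayficationE8OffCentreRegularChar3
import Mathlib.Algebra.MvPolynomial.PDeriv
import Mathlib.Algebra.CharP.Lemmas
import HarnessLib

/-!
# The chart rings of `Bl_𝔪 E₈⁰` in characteristic `3` are regular off the `E₇⁰` point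

Support file for crux stmt-ResolutionOfSingularities-15315
(`FrobeniusLadder.FInjectiveMacaulayfication`, line `Sketch`, seat c6): stub
`stub_e8Char3ChartRingsRegular` — the calibration of the crux's blow-up engine on
`E₈⁰ : X₂² + X₀³ + X₁⁵ = 0` in characteristic `3`.

Let `k` be a field of characteristic `3` and `S = k[X₀, X₁, X₂]`. The point blow-up `Bl_𝔪 E₈⁰` is
covered by two affine charts with coordinate rings

* the `x`-chart `S/(gₓ)`, `gₓ = X₂² + X₀ + X₀³X₁⁵` (upstairs `X 0 = x`, `X 1 = y/x`, `X 2 = z/x`);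
* the `y`-chart `S/(g_y)`, `g_y = X₂² + X₁X₀³ + X₁³` (upstairs `X 0 = x/y`, `X 1 = y`, `X 2 = z/y`).

The characteristic-`3` tower needs: EVERY local ring of the `x`-chart is regular, and every local
ring of the `y`-chart other than the one at the origin `(X̄₀, X̄₁, X̄₂)` (the unique bad point, an
`E₇⁰`-type point) is regular.

Proof (`stub_e8Char3ChartRingsRegular`).

* `x`-chart: over any commutative ring `∂gₓ/∂X₀ = 1 + X₀ · (3 X₀ X₁⁵)`
  (`E8ChartXPoints.pderiv_zero_gx`), and `3 = 0` in `S` in characteristic `3`, so `∂gₓ/∂X₀ = 1`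
  (`pderiv_zero_gx_char3`), which lies in no proper ideal; the Jacobian criterion at an arbitrary
  prime of a hypersurface (`HypersurfaceRegular.stub_hypersurfaceRegularOfPderiv`,
  [Matsumura1987] Thm. 30.4 (ii), direction `i = 0`) makes `(S/(gₓ))_Q` regular for every prime `Q`.
* `y`-chart: `S/(g_y)` is the `E₇⁰`-type hypersurface of `E7OffCentreRegular.stub_e7OffCentreRegular`,
  which is regular at every prime `Q` not containing `(X̄₀, X̄₁, X̄₂)`; and a prime `Q` containing
  `(X̄₀, X̄₁, X̄₂)` pulls back to a prime `P = Q ∩ S ⊇ (X₀, X₁, X₂)`, a maximal ideal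
  (`Fedder.isMaximal_span_range_X`, through `E8ChartYPoints.eq_span_range_X_of_mem`), so
  `P = (X₀, X₁, X₂)` and `Q = P · (S/(g_y))` (`Ideal.map_comap_of_surjective`) IS the origin
  (`eq_map_span_range_X_of_le`) — excluded by hypothesis.

References: H. Matsumura, *Commutative Ring Theory*, Cambridge Stud. Adv. Math. 8, CUP 1986,
Thm. 30.4 (ii) [Matsumura1987] (through the imported Jacobian criterion); M. Artin, *Coverings of
the rational double points in characteristic `p`*, in: Complex Analysis and Algebraic Geometry,
Iwanami Shoten 1977 [Artin1977] (the forms `E₈⁰`, `E₇⁰` and `Bl_𝔪 E₈⁰ → E₇⁰`, context only). The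
computation itself is folklore.
-/

-- single-problem summit: the doubled namespace component is forced
set_option linter.dupNamespace false

noncomputable section

namespace Summit.ResolutionOfSingularities.ResolutionOfSingularities.Theorems.FInjectiveMacaulayfication.E8Char3ChartRingsRegular

open MvPolynomial
open Summit.ResolutionOfSingularities.ResolutionOfSingularities.Theorems.FInjectiveMacaulayfication

/-- **`3 = 0` in `k[X₀, X₁, X₂]` in characteristic `3`**: `3 = C 3` (`map_ofNat`) and `(3 : k) = 0`
(`E7OffCentreRegular.three_eq_zero_of_charP_three`). [folklore] -/
theorem three_eq_zero (k : Type) [Field k] [CharP k 3] : (3 : MvPolynomial (Fin 3) k) = 0 := by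
  rw [← map_ofNat (C : k →+* MvPolynomial (Fin 3) k) 3,
    E7OffCentreRegular.three_eq_zero_of_charP_three, map_zero]

/-- **`∂gₓ/∂X₀ = 1` in characteristic `3`** for `gₓ = X₂² + X₀ + X₀³X₁⁵`: over any commutative ring
`∂gₓ/∂X₀ = 1 + X₀ · (3 X₀ X₁⁵)` (`E8ChartXPoints.pderiv_zero_gx`), and `3 = 0` in characteristic `3`
(`three_eq_zero`). [folklore] -/
theorem pderiv_zero_gx_char3 (k : Type) [Field k] [CharP k 3] (gx : MvPolynomial (Fin 3) k)
    (hgx : gx = X 2 ^ 2 + X 0 + X 0 ^ 3 * X 1 ^ 5) : pderiv 0 gx = 1 := by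
  rw [hgx, E8ChartXPoints.pderiv_zero_gx, three_eq_zero, zero_mul, zero_mul, mul_zero, add_zero]

/-- **A prime of `S/(g)` containing `(X̄₀, X̄₁, X̄₂)` is the origin** (`S = k[X₀, X₁, X₂]`, `k` a field,
`g ∈ S` arbitrary): if `(X̄₀, X̄₁, X̄₂) ≤ Q` then `P = Q ∩ S` is a prime containing `X₀, X₁, X₂`, hence
equal to the maximal ideal `(X₀, X₁, X₂)` (`E8ChartYPoints.eq_span_range_X_of_mem`, via
`Fedder.isMaximal_span_range_X`), and `Q = P · (S/(g))` (`Ideal.map_comap_of_surjective` for the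
quotient map). [folklore] -/
theorem eq_map_span_range_X_of_le (k : Type) [Field k] (g : MvPolynomial (Fin 3) k)
    (Q : Ideal (MvPolynomial (Fin 3) k ⧸ Ideal.span {g})) [Q.IsPrime]
    (hle : Ideal.span (Set.range fun j : Fin 3 => Ideal.Quotient.mk (Ideal.span {g}) (X j)) ≤ Q) :
    Q = Ideal.map (Ideal.Quotient.mk (Ideal.span {g}))
      (Ideal.span (Set.range (X : Fin 3 → MvPolynomial (Fin 3) k))) := by
  haveI hprime : (Q.comap (Ideal.Quotient.mk (Ideal.span {g}))).IsPrime := Ideal.comap_isPrime _ _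
  have hX : ∀ j : Fin 3, (X j : MvPolynomial (Fin 3) k) ∈ Q.comap (Ideal.Quotient.mk (Ideal.span {g})) :=
    fun j => Ideal.mem_comap.mpr (hle (Ideal.subset_span ⟨j, rfl⟩))
  have hP : Q.comap (Ideal.Quotient.mk (Ideal.span {g})) =
      Ideal.span (Set.range (X : Fin 3 → MvPolynomial (Fin 3) k)) :=
    E8ChartYPoints.eq_span_range_X_of_mem k _ (hX 0) (hX 1) (hX 2)
  rw [← hP, Ideal.map_comap_of_surjective _ Ideal.Quotient.mk_surjective]

/-- **The chart rings of `Bl_𝔪 E₈⁰` in characteristic `3` are regular off the `E₇⁰` point**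
(registered stub `stub_e8Char3ChartRingsRegular` of line `Sketch`): for a field `k` of
characteristic `3`, `S = k[X₀, X₁, X₂]`, `gₓ = X₂² + X₀ + X₀³X₁⁵` and `g_y = X₂² + X₁X₀³ + X₁³`
(the two chart equations of the point blow-up of `E₈⁰ : X₂² + X₀³ + X₁⁵ = 0`):
(1) `(S/(gₓ))_Q` is a regular local ring for EVERY prime `Q` of `S/(gₓ)` — in characteristic `3`,
`∂gₓ/∂X₀ = 1` (`pderiv_zero_gx_char3`) lies in no proper ideal, and the Jacobian criterion at an
arbitrary prime (`HypersurfaceRegular.stub_hypersurfaceRegularOfPderiv`, direction `i = 0`) applies;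
(2) `(S/(g_y))_Q` is a regular local ring for every prime `Q` of `S/(g_y)` other than the origin
`(X̄₀, X̄₁, X̄₂)` — a prime containing `(X̄₀, X̄₁, X̄₂)` is the origin (`eq_map_span_range_X_of_le`),
so `Q ⊉ (X̄₀, X̄₁, X̄₂)` and the `E₇⁰`-type hypersurface `S/(g_y)` is regular at `Q`
(`E7OffCentreRegular.stub_e7OffCentreRegular`: Jacobian criterion in the directions `∂/∂X₂ = 2X₂`,
`∂/∂X₁ = X₀³` in characteristic `3`). [cite: Matsumura1987, Thm. 30.4 (ii)] for the Jacobian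
criterion; the computation is folklore. -/
theorem stub_e8Char3ChartRingsRegular : ∀ (k : Type) [Field k] [CharP k 3] (gx gy : MvPolynomial (Fin 3) k),
    gx = MvPolynomial.X 2 ^ 2 + MvPolynomial.X 0 + MvPolynomial.X 0 ^ 3 * MvPolynomial.X 1 ^ 5 →
    gy = MvPolynomial.X 2 ^ 2 + MvPolynomial.X 1 * MvPolynomial.X 0 ^ 3 + MvPolynomial.X 1 ^ 3 →
    (∀ (Q : Ideal (MvPolynomial (Fin 3) k ⧸ Ideal.span {gx})) [Q.IsPrime],
      IsRegularLocalRing (Localization.AtPrime Q)) ∧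
    (∀ (Q : Ideal (MvPolynomial (Fin 3) k ⧸ Ideal.span {gy})) [Q.IsPrime],
      Q ≠ Ideal.map (Ideal.Quotient.mk (Ideal.span {gy}))
        (Ideal.span (Set.range (MvPolynomial.X : Fin 3 → MvPolynomial (Fin 3) k))) →
      IsRegularLocalRing (Localization.AtPrime Q)) := by
  intro k _ _ gx gy hgx hgy
  refine ⟨fun Q hQ => ?_, fun Q _ hQ => ?_⟩
  · -- `x`-chart: Jacobian criterion in the direction `∂/∂X₀`, where `∂gₓ/∂X₀ = 1 ∉ P = Q ∩ S`
    refine HypersurfaceRegular.stub_hypersurfaceRegularOfPderiv k 3 gx 0 Q (fun hd => ?_)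
    rw [pderiv_zero_gx_char3 k gx hgx] at hd
    exact Ideal.comap_ne_top _ hQ.ne_top ((Ideal.eq_top_iff_one _).mpr hd)
  · -- `y`-chart: `Q` is not the origin, so `(X̄₀, X̄₁, X̄₂) ≰ Q` and the `E₇⁰`-type chart ring is
    -- regular at `Q`
    exact E7OffCentreRegular.stub_e7OffCentreRegular k gy hgy Q
      (fun hle => hQ (eq_map_span_range_X_of_le k gy Q hle))

end Summit.ResolutionOfSingularities.ResolutionOfSingularities.Theorems.FInjectiveMacaulayfication.E8Char3ChartRingsRegular

end
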